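import Summits.QuantumFields.YangMills.Theses.ParabolicTrajectory
import Summits.QuantumFields.YangMills.Theorems.TunedSequenceExists.Negative.AtZeroFalse

/-!
# `TunedSequenceExists` — the exact finitary form of the crux body (no schemes, no limits)

Crux `Summit.QuantumFields.YangMills.Theses.ParabolicTrajectory.TunedSequenceExists` (item
stmt-QuantumFields-10524, (S) of route ParabolicTrajectory; lead c2 of its line chain, helper landed
`--supports`).  Write `N_t(β, m, L) := (M^m)^8 ⟨P ; τ_{t M^m} P⟩_{β, 2L+1}` for the rescaled connected
curvature two-point function of the Wilson theory at the raw lattice data `(β, m, L, t)`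
(`P = r.curvature.F`).  The crux body at fixed `(G, r, M)` quantifies over `M`-adic species SCHEMES
with `β_k → ∞` and asks for limits of `N_t` along them.  `window_iff_finitary` shows (for `M ≥ 2`)
that it is EQUIVALENT to a statement about the finite-lattice table `N_t(β, m, L)` alone:

  `∃ θ₀ > 0, ∀ θ ∈ (0, θ₀), ∃ K : ℕ → ℝ, ∀ ε > 0, ∀ B m₀ L₀, ∃ m ≥ m₀, ∃ L ≥ L₀ M^m, ∃ β ≥ B,`
  `|N_1(β, m, L) - θ| ≤ ε ∧ ∀ t ≥ 2, |N_t(β, m, L)| ≤ K t`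

— every small `θ` is APPROXIMATELY attained beyond every coupling, depth and volume floor, with an
a-priori bound on the higher separations that is uniform in the accuracy.  (`→`: read the data off a
witness scheme, `K t = sup_k |N_t(k)|`; `←`: stage `k` uses `ε = 1/(k+1)`, `B = m₀ = L₀ = k`, the
resulting scheme has `a_k L_k ≥ k`, `β_k ≥ k`, `N_1(k) → θ` and bounded `N_t`, and a diagonal
subsequence (Tychonoff on `∏_t [-K t, K t]`) makes every `N_t` converge; re-indexing a scheme along a
strictly increasing map is again a scheme.)  `tunedSequenceExists_iff_finitary` is the global form.

Purpose (routing evidence, lead c2): the crux is a statement about Wilson's finite-torus correlator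
table only; its two analytic ingredients are visible in the finitary form — the window LOWER bound
(`|N_1 - θ| ≤ ε` beyond every `B`, cf. `Negative.Glue.weak_iff_lowerBound`) and the a-priori bound
`|N_t| ≤ K t`, which is NOT reflection-positivity glue for the corner action density (crux workfile
`RPStraddleCounterexample.lean`).  No definition is introduced; the re-indexed and the staged schemes
are built as anonymous structure terms inside the proofs.
-/

noncomputable section

open Filter Topology MeasureTheory
open Literature.MathematicalPhysics.QuantumFieldTheory Literature.MathematicalPhysics.QuantumLattice
open Summit.QuantumFields.YangMills.Theorems.TunedSequenceExists.Negative.AtZeroFalse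
  (tendsto_exponent_of_shape eventually_sep_le_L)

namespace Summit.QuantumFields.YangMills.Theorems.TunedSequenceExists.Finitary

variable {G : Type} [Group G] [TopologicalSpace G] [IsTopologicalGroup G] [CompactSpace G]
  [MeasurableSpace G] [BorelSpace G]

/-- **Diagonal extraction** (the content of clause (iii) beyond boundedness is nil): an `M`-adic
scheme with `β_k → ∞`, tuned limit `θ` and every `N_t`, `t ≥ 1`, BOUNDED has a re-indexing along
which every `N_t` converges — again an `M`-adic scheme with `β → ∞` and tuned limit `θ`. -/
theorem exists_scheme_of_bounded (r : LatticeRep G) (M : ℕ) (θ : ℝ)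
    (sch : SpeciesScheme (YMSpecies G)) (n : ℕ → ℕ)
    (hshape : ∀ k, sch.a k = ((M : ℝ) ^ n k)⁻¹) (hβ : Tendsto sch.β atTop atTop)
    (hbdd : ∀ t : ℕ, 0 < t → ∃ C : ℝ, ∀ k, |((M : ℝ) ^ n k) ^ 8 *
      latticeConnectedCorr r.ρ (sch.β k) (sch.side k) r.curvature.F r.curvature.F (t * M ^ n k)| ≤ C)
    (hlim : Tendsto (fun k => ((M : ℝ) ^ n k) ^ 8 *
      latticeConnectedCorr r.ρ (sch.β k) (sch.side k) r.curvature.F r.curvature.F (M ^ n k))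
      atTop (𝓝 θ)) :
    ∃ (sch' : SpeciesScheme (YMSpecies G)) (n' : ℕ → ℕ),
      (∀ k, sch'.a k = ((M : ℝ) ^ n' k)⁻¹) ∧ Tendsto sch'.β atTop atTop ∧
      (∀ t : ℕ, 0 < t → ∃ c : ℝ, Tendsto (fun k => ((M : ℝ) ^ n' k) ^ 8 *
          latticeConnectedCorr r.ρ (sch'.β k) (sch'.side k) r.curvature.F r.curvature.F
            (t * M ^ n' k)) atTop (𝓝 c)) ∧
      Tendsto (fun k => ((M : ℝ) ^ n' k) ^ 8 *
          latticeConnectedCorr r.ρ (sch'.β k) (sch'.side k) r.curvature.F r.curvature.F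
            (M ^ n' k)) atTop (𝓝 θ) := by
  -- the family of rescaled correlators, indexed by `t' = t - 1`
  set u : ℕ → ℕ → ℝ := fun k t' => ((M : ℝ) ^ n k) ^ 8 *
    latticeConnectedCorr r.ρ (sch.β k) (sch.side k) r.curvature.F r.curvature.F
      ((t' + 1) * M ^ n k) with hu
  choose C hC using fun t' : ℕ => hbdd (t' + 1) (Nat.succ_pos t')
  set K : Set (ℕ → ℝ) := Set.pi Set.univ fun t' => Set.Icc (-C t') (C t') with hK
  have hKc : IsCompact K := isCompact_univ_pi fun t' => isCompact_Icc
  have huK : ∀ k, u k ∈ K := fun k => by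
    simp only [hK, Set.mem_pi, Set.mem_univ, true_implies, Set.mem_Icc]
    intro t'
    exact abs_le.1 (hC t' k)
  obtain ⟨lim, -, φ, hφ, hconv⟩ := hKc.tendsto_subseq huK
  -- the re-indexed scheme (an anonymous structure term; no definition is introduced)
  refine ⟨{ a := sch.a ∘ φ
            a_pos := fun k => sch.a_pos (φ k)
            tendsto_a := sch.tendsto_a.comp hφ.tendsto_atTop
            β := sch.β ∘ φ
            L := sch.L ∘ φ
            tendsto_L := sch.tendsto_L.comp hφ.tendsto_atTop
            c := fun s => sch.c s ∘ φ
            m := fun s => sch.m s ∘ φ }, n ∘ φ, fun k => hshape (φ k), hβ.comp hφ.tendsto_atTop,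
    ?_, ?_⟩
  · intro t ht
    obtain ⟨t', rfl⟩ := Nat.exists_eq_succ_of_ne_zero ht.ne'
    refine ⟨lim t', ?_⟩
    have h1 : Tendsto (fun j => u (φ j) t') atTop (𝓝 (lim t')) := tendsto_pi_nhds.1 hconv t'
    refine h1.congr fun j => ?_
    simp only [hu, Function.comp_apply, Nat.succ_eq_add_one]
    rfl
  · exact hlim.comp hφ.tendsto_atTop

/-- **The crux body at fixed `(G, r, M)` is its finitary form** (`M ≥ 2`): see the module docstring.
The left-hand side is the body of `ParabolicTrajectory.TunedSequenceExists` at `(G, r, M)` verbatim. -/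
theorem window_iff_finitary (r : LatticeRep G) {M : ℕ} (hM : 2 ≤ M) :
    (∃ θ₀ : ℝ, 0 < θ₀ ∧ ∀ θ : ℝ, 0 < θ → θ < θ₀ →
      ∃ (sch : SpeciesScheme (YMSpecies G)) (n : ℕ → ℕ),
        (∀ k, sch.a k = ((M : ℝ) ^ n k)⁻¹) ∧ Tendsto sch.β atTop atTop ∧
        (∀ t : ℕ, 0 < t → ∃ c : ℝ, Tendsto (fun k => ((M : ℝ) ^ n k) ^ 8 *
            latticeConnectedCorr r.ρ (sch.β k) (sch.side k) r.curvature.F r.curvature.F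
              (t * M ^ n k)) atTop (𝓝 c)) ∧
        Tendsto (fun k => ((M : ℝ) ^ n k) ^ 8 *
            latticeConnectedCorr r.ρ (sch.β k) (sch.side k) r.curvature.F r.curvature.F
              (M ^ n k)) atTop (𝓝 θ)) ↔
    (∃ θ₀ : ℝ, 0 < θ₀ ∧ ∀ θ : ℝ, 0 < θ → θ < θ₀ → ∃ K : ℕ → ℝ, ∀ ε : ℝ, 0 < ε →
      ∀ (B : ℝ) (m₀ L₀ : ℕ), ∃ m : ℕ, m₀ ≤ m ∧ ∃ L : ℕ, L₀ * M ^ m ≤ L ∧ ∃ β : ℝ, B ≤ β ∧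
        |((M : ℝ) ^ m) ^ 8 *
            latticeConnectedCorr r.ρ β (2 * L + 1) r.curvature.F r.curvature.F (M ^ m) - θ| ≤ ε ∧
        ∀ t : ℕ, 2 ≤ t → |((M : ℝ) ^ m) ^ 8 *
            latticeConnectedCorr r.ρ β (2 * L + 1) r.curvature.F r.curvature.F (t * M ^ m)| ≤ K t) := by
  constructor
  · -- `→`: read the data off a witness scheme
    rintro ⟨θ₀, hθ₀, h⟩
    refine ⟨θ₀, hθ₀, fun θ hθ hθ' => ?_⟩
    obtain ⟨sch, n, hshape, hβ, hconv, hlim⟩ := h θ hθ hθ'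
    -- uniform bounds `K t` on `|N_t(k)|` (for `t = 0` the bound is never used)
    have hb : ∀ t : ℕ, ∃ C : ℝ, 0 < t → ∀ k, |((M : ℝ) ^ n k) ^ 8 *
        latticeConnectedCorr r.ρ (sch.β k) (sch.side k) r.curvature.F r.curvature.F
          (t * M ^ n k)| ≤ C := by
      intro t
      rcases Nat.eq_zero_or_pos t with rfl | ht
      · exact ⟨0, fun h => absurd h (lt_irrefl 0)⟩
      · obtain ⟨c, hc⟩ := hconv t ht
        obtain ⟨C, hC⟩ := isBounded_iff_forall_norm_le.1 (Metric.isBounded_range_of_tendsto _ hc)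
        exact ⟨C, fun _ k => by simpa [Real.norm_eq_abs] using hC _ (Set.mem_range_self k)⟩
    choose K hK using hb
    refine ⟨K, fun ε hε B m₀ L₀ => ?_⟩
    have hev1 : ∀ᶠ k in atTop, B ≤ sch.β k := tendsto_atTop.1 hβ B
    have hev2 : ∀ᶠ k in atTop, m₀ ≤ n k :=
      tendsto_atTop.1 (tendsto_exponent_of_shape hM sch hshape) m₀
    have hev3 : ∀ᶠ k in atTop, L₀ * M ^ n k ≤ sch.L k := eventually_sep_le_L sch hshape L₀
    have hev4 : ∀ᶠ k in atTop, |((M : ℝ) ^ n k) ^ 8 *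
        latticeConnectedCorr r.ρ (sch.β k) (sch.side k) r.curvature.F r.curvature.F (M ^ n k) - θ|
          ≤ ε := by
      have := (Metric.tendsto_nhds.1 hlim) ε hε
      exact this.mono fun k hk => by simpa [Real.dist_eq] using hk.le
    obtain ⟨k, hk1, hk2, hk3, hk4⟩ := (hev1.and (hev2.and (hev3.and hev4))).exists
    refine ⟨n k, hk2, sch.L k, hk3, sch.β k, hk1, ?_, fun t ht => ?_⟩
    · simpa [SpeciesScheme.side] using hk4
    · simpa [SpeciesScheme.side] using hK t (by omega) k
  · -- `←`: stage `k` at accuracy `1/(k+1)`, floors `k`; then diagonal extraction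
    rintro ⟨θ₀, hθ₀, h⟩
    refine ⟨θ₀, hθ₀, fun θ hθ hθ' => ?_⟩
    obtain ⟨K, hK⟩ := h θ hθ hθ'
    have hstage := fun k : ℕ => hK (1 / ((k : ℝ) + 1)) (by positivity) (k : ℝ) k k
    choose m hm L hL β hβ happrox hapr using hstage
    have hM1 : (1 : ℝ) < M := by exact_mod_cast hM
    have hm_top : Tendsto m atTop atTop := tendsto_atTop_mono hm tendsto_id
    have hpow_top : Tendsto (fun k => (M : ℝ) ^ m k) atTop atTop :=
      (tendsto_pow_atTop_atTop_of_one_lt hM1).comp hm_top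
    -- the staged scheme (anonymous structure term)
    let sch : SpeciesScheme (YMSpecies G) :=
      { a := fun k => ((M : ℝ) ^ m k)⁻¹
        a_pos := fun k => by positivity
        tendsto_a := tendsto_inv_atTop_zero.comp hpow_top
        β := β
        L := L
        tendsto_L := by
          refine tendsto_atTop_mono (fun k => ?_) tendsto_natCast_atTop_atTop
          have hLk : (k : ℝ) * (M : ℝ) ^ m k ≤ L k := by exact_mod_cast hL k
          have hp : (0 : ℝ) < (M : ℝ) ^ m k := by positivity
          show (k : ℝ) ≤ ((M : ℝ) ^ m k)⁻¹ * (L k : ℝ)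
          rw [inv_mul_eq_div, le_div_iff₀ hp]
          exact hLk
        c := fun _ _ => 0
        m := fun _ _ => 0 }
    have hβtop : Tendsto sch.β atTop atTop :=
      tendsto_atTop_mono (fun k => hβ k) tendsto_natCast_atTop_atTop
    -- the tuned limit: `|N_1(k) - θ| ≤ 1/(k+1) → 0`
    have hlim : Tendsto (fun k => ((M : ℝ) ^ m k) ^ 8 *
        latticeConnectedCorr r.ρ (sch.β k) (sch.side k) r.curvature.F r.curvature.F (M ^ m k))
        atTop (𝓝 θ) := by
      have h0 : Tendsto (fun k : ℕ => 1 / ((k : ℝ) + 1)) atTop (𝓝 0) :=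
        tendsto_one_div_add_atTop_nhds_zero_nat
      refine Metric.tendsto_nhds.2 fun ε hε => ?_
      filter_upwards [(Metric.tendsto_nhds.1 h0) ε hε] with k hk
      have hk' : 1 / ((k : ℝ) + 1) < ε := by
        have : |1 / ((k : ℝ) + 1) - 0| < ε := by simpa [Real.dist_eq] using hk
        rw [sub_zero, abs_of_pos (by positivity)] at this
        exact this
      rw [Real.dist_eq]
      exact (happrox k).trans_lt hk'
    -- boundedness of every `N_t`, `t ≥ 1`
    have hbdd : ∀ t : ℕ, 0 < t → ∃ C : ℝ, ∀ k, |((M : ℝ) ^ m k) ^ 8 *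
        latticeConnectedCorr r.ρ (sch.β k) (sch.side k) r.curvature.F r.curvature.F
          (t * M ^ m k)| ≤ C := by
      intro t ht
      rcases Nat.lt_or_ge t 2 with ht2 | ht2
      · obtain rfl : t = 1 := by omega
        obtain ⟨C, hC⟩ := isBounded_iff_forall_norm_le.1 (Metric.isBounded_range_of_tendsto _ hlim)
        exact ⟨C, fun k => by simpa [Real.norm_eq_abs] using hC _ (Set.mem_range_self k)⟩
      · exact ⟨K t, fun k => hapr k t ht2⟩
    exact exists_scheme_of_bounded r M θ sch m (fun k => rfl) hβtop hbdd hlim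

/-- **`TunedSequenceExists` in finitary form** (global corollary of `window_iff_finitary`): the crux is
the statement, for every compact simple `G`, faithful unitary `r` and `M ≥ 2`, that the finite-torus
correlator table `N_t(β, m, L)` of Wilson's lattice Yang–Mills theory has a window `(0, θ₀)` every
point of which is approximately attained (to every accuracy, beyond every coupling, depth and volume
floor) together with an accuracy-uniform a-priori bound on `N_t`, `t ≥ 2`. -/
theorem tunedSequenceExists_iff_finitary :
    Summit.QuantumFields.YangMills.Theses.ParabolicTrajectory.TunedSequenceExists ↔
      ∀ (G : Type) [Group G] [TopologicalSpace G] [IsTopologicalGroup G] [CompactSpace G],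
        IsCompactSimpleLieGroup G → letI : MeasurableSpace G := borel G
        haveI : BorelSpace G := ⟨rfl⟩
        ∀ (r : LatticeRep G) (M : ℕ), 2 ≤ M →
          ∃ θ₀ : ℝ, 0 < θ₀ ∧ ∀ θ : ℝ, 0 < θ → θ < θ₀ → ∃ K : ℕ → ℝ, ∀ ε : ℝ, 0 < ε →
            ∀ (B : ℝ) (m₀ L₀ : ℕ), ∃ m : ℕ, m₀ ≤ m ∧ ∃ L : ℕ, L₀ * M ^ m ≤ L ∧ ∃ β : ℝ, B ≤ β ∧
              |((M : ℝ) ^ m) ^ 8 *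
                  latticeConnectedCorr r.ρ β (2 * L + 1) r.curvature.F r.curvature.F (M ^ m) - θ|
                ≤ ε ∧
              ∀ t : ℕ, 2 ≤ t → |((M : ℝ) ^ m) ^ 8 *
                  latticeConnectedCorr r.ρ β (2 * L + 1) r.curvature.F r.curvature.F (t * M ^ m)|
                ≤ K t := by
  constructor
  · intro h G _ _ _ _ hG
    letI : MeasurableSpace G := borel G
    haveI : BorelSpace G := ⟨rfl⟩
    intro r M hM
    exact (window_iff_finitary r hM).1 (h G hG r M hM)
  · intro h G _ _ _ _ hG
    letI : MeasurableSpace G := borel G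
    haveI : BorelSpace G := ⟨rfl⟩
    intro r M hM
    exact (window_iff_finitary r hM).2 (h G hG r M hM)

end Summit.QuantumFields.YangMills.Theorems.TunedSequenceExists.Finitary

end
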